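import Summits.Ventures.HSemireg.WedgeHankelRecurrenceSignatureSturm

/-!
# Venture HSemireg — HERMITE–HURWITZ: THE SIGNATURE OF THE HANKEL FORM OF `a/P` IS THE CAUCHY INDEX OF `a/P`, for `P` monic real with SIMPLE ROOTS (separable) and ANY numerator `a`:
# **`Sign H_t(a/P) = Σ_{x ∈ roots_ℝ P} sign(a(x)·P′(x)) = Ind(a/P)`** (the tree's `cauchyIndex P a lo hi` on a window containing the real roots), with the two indices
# **`sigPos = #{x : a(x)P′(x) > 0} + #{z : Im z > 0, P(z) = 0, a(z) ≠ 0}`**, **`sigNeg = #{x : a(x)P′(x) < 0} + #{same pairs}`** — BPR Thm. 9.4 (signature half) ∕ Gantmacher XV §11 in the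
# squarefree case, reduced to N128 ∕ N129 by the Bézout identity `u P + v P′ = 1`: `a ≡ (a v)·P′ (mod P)`

HONEST FRAMING. Part of the Lean index of the computation cell `pub-hsemireg` (seat p10 gen 35, Sunday typer «UNIFORM-IN-n»).
LINEAR ALGEBRA OF HANKEL (catalecticant) MATRICES AND REAL ∕ COMPLEX POLYNOMIALS ONLY (Mathlib's `sigPos` ∕ `sigNeg`, `Polynomial.Separable`, PROVED Literature `CauchyIndex` ∕ `TarskiQuery`): no
variety, no cohomology theory, no sheaf, no Ext group and no semiregularity map is constructed here; nothing here says that HC / HC_CM / HC_AV holds; no Literature fact (unproved `Prop`) is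
declared or used.  Custodian versions as in `WedgeHankelSiegelIdeal` (1/3).
SOURCE OF THE ARGUMENT (classical; cited, the BPR text was read, pp. 326–335): C. Hermite (1856), A. Hurwitz, *Über die Bedingungen, unter welchen eine Gleichung nur Wurzeln mit negativen reellen Theilen
besitzt*, Math. Ann. 46 (1895) (signature of the Hankel form of a rational function = Cauchy index); F. R. Gantmacher, *The Theory of Matrices* II, Ch. XV §11 Thm. 9; S. Basu, R. Pollack, M.-F. Roy
(2006) **Thm. 9.4** «`Sign(Bez(P,Q)) = Ind(Q/P)`» with **Prop. 9.20** (Bezoutian = Hankel form) and **Remark 2.55 (b)** «`Ind(Q/P) = Ind(R/P)`, `R = Rem(Q,P)`», **Prop. 2.57** «`TaQ(Q,P) = Ind(P′Q/P)`».  Here only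
the case `gcd(P, P′) = 1`: then every numerator is a Hermite numerator modulo `P`, `a ≡ (a·v)·P′` with `u P + v P′ = 1`, and at a root `x` (real or complex) `v(x) P′(x) = 1`.
DEDUP DISCLOSURE (`rg` of the whole tree + Mathlib, 2026-09-01): N128 ∕ N129 (`WedgeHankelRecurrenceSignatureReal ∕ …Sturm`) give the inertia and `Sign = TaQ` for numerators of the HERMITE shape `Q·P′`;
Literature `TarskiQuery.tarskiQuery_eq_cauchyIndex` (`TaQ(Q,P) = Ind(P′Q/P)`) and `cauchyIndex_mod` are PROVED and IMPORTED; no file states the signature or inertia of `H_t(a/P)` for an ARBITRARY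
numerator `a`, nor equates a Hankel signature with `cauchyIndex P a` — that is this file (separable `P`).  7 names: 0 hits tree-wide.

WHAT IS IN THE TREE.  N32 `dualSeq`, `dualSeq_congr_mod` (`m ∣ a − b ⇒ dualSeq m a = dualSeq m b`); N128 `sigPos_sigNeg_hankelSq_dualSeq_mul_derivative_real` (inertia of `H_t(Q·P′/P)` over `ℝ` with conjugate pairs);
N129 `sigPos_sub_sigNeg_hankelSq_dualSeq_mul_derivative_real` (`= Σ_{x} sign Q(x)`), `tarskiQuery_eq_sum_sign`; Literature `TarskiQuery`: `tarskiQuery`, **`tarskiQuery_eq_cauchyIndex`**, **`cauchyIndex_mod`**;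
`CauchyIndex`: `cauchyIndex`.  Mathlib: `Polynomial.separable_def`, `Polynomial.modByMonic_eq_mod`, `Polynomial.modByMonic_eq_of_dvd_sub`, `sign_mul`, `Polynomial.mem_roots`, `Polynomial.eval_map`-type
bookkeeping (`Polynomial.eval₂`/`aeval` avoided: `(f.map (algebraMap ℝ ℂ)).eval z`).
THIS FILE (namespace `Summit.Ventures.HSemireg.Wedge.HankelOuter` continued; PLAIN on N129 (hence N128, N32, Literature `TarskiQuery` ∕ `CauchyIndex`); 0 definitions):
* §757 `dualSeq_eq_dualSeq_mul_mul_derivative`, `eval_mul_eval_derivative_eq_one` (bookkeeping), **`sigPos_sub_sigNeg_hankelSq_dualSeq_real_of_isCoprime`** (`u P + v P′ = 1` ⇒ `Sign H_t(a/P) = Σ_{x ∈ roots_ℝ P} sign(a(x) P′(x))`), **`sigPos_sigNeg_hankelSq_dualSeq_real_of_isCoprime`** (the two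
  indices with the conjugate-pair count `#{Im z > 0, P(z) = 0, a(z) ≠ 0}`), `sigPos_sub_sigNeg_hankelSq_dualSeq_real_of_separable` (the same from `P.Separable`).
* §758 **`sigPos_sub_sigNeg_hankelSq_dualSeq_eq_cauchyIndex`** (HERMITE–HURWITZ ∕ BPR Thm. 9.4 (2) for separable monic `P`: `Sign H_t(a/P) = cauchyIndex P a lo hi` whenever the real roots of `P` lie
  in `(lo, hi)`), `cauchyIndex_eq_sum_sign_mul_derivative` (`Ind(a/P; lo, hi) = Σ sign(a(x)P′(x))`, simple real roots, any `a`).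
CAVEATS.  `P` MONIC and SEPARABLE (`IsCoprime P P′`): for a multiple root the numerators `Q·P′ mod P` do not exhaust `K[X]/(P)` and the higher-order pole contributions (BPR Lemma 9.5 shape, N145) are
needed — the general Thm. 9.4 (2) is NOT typed here; `R = ℝ` (N128's conjugate-pair count uses `ℂ`); the window `(lo, hi)` only packages «all real roots» for the tree's finite-interval `cauchyIndex`.
Nothing Ext-side.  New names only.
-/

open Module Polynomial
open scoped Matrix Polynomial

namespace Summit.Ventures.HSemireg.Wedge.HankelOuter

open Summit.Ventures.HSemireg.Wedge Summit.Ventures.HSemireg.Wedge.Hankel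

/-! ## §757. Every numerator is a Hermite numerator modulo a separable `P`: `a ≡ (a v) P′`, `u P + v P′ = 1` -/

/-- `u P + v P′ = 1 ⇒ dualSeq P a = dualSeq P ((a·v)·P′)` (`a − a v P′ = a u P`). [bookkeeping] -/
theorem dualSeq_eq_dualSeq_mul_mul_derivative {K : Type*} [Field K] {P u v : K[X]} (hP : P.Monic) (huv : u * P + v * derivative P = 1) (a : K[X]) :
    dualSeq K P a = dualSeq K P (a * v * derivative P) :=
  dualSeq_congr_mod K hP ⟨a * u, by linear_combination (-a) * huv⟩

/-- At a root `x` of `P`, `u P + v P′ = 1` gives `v(x)·P′(x) = 1`. [bookkeeping] -/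
theorem eval_mul_eval_derivative_eq_one {K : Type*} [Field K] {P u v : K[X]} (huv : u * P + v * derivative P = 1) {x : K} (hx : P.eval x = 0) : v.eval x * (derivative P).eval x = 1 := by
  have h := congrArg (Polynomial.eval x) huv
  rw [eval_add, eval_mul, eval_mul, hx, mul_zero, zero_add, eval_one] at h
  exact h

/-- **`Sign H_t(a/P) = Σ_{x ∈ roots_ℝ P} sign(a(x)·P′(x))` for `P` monic real with `u P + v P′ = 1` (simple roots), `deg P ≤ t + 1`, ANY numerator `a`** (N129 applied to `Q = a v`; at a root
`sign v(x) = sign P′(x)`). [this file, §757] -/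
theorem sigPos_sub_sigNeg_hankelSq_dualSeq_real_of_isCoprime {t : ℕ} {P u v : ℝ[X]} (hP : P.Monic) (hPd : P.natDegree ≤ t + 1) (huv : u * P + v * derivative P = 1) (a : ℝ[X]) :
    (sigPos (hankelSq ℝ t (dualSeq ℝ P a)).toQuadraticForm' : ℤ) - sigNeg (hankelSq ℝ t (dualSeq ℝ P a)).toQuadraticForm'
      = ∑ x ∈ P.roots.toFinset, (SignType.sign (a.eval x * (derivative P).eval x) : ℤ) := by
  rw [dualSeq_eq_dualSeq_mul_mul_derivative hP huv a, sigPos_sub_sigNeg_hankelSq_dualSeq_mul_derivative_real hP hPd (a * v)]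
  refine Finset.sum_congr rfl fun x hx => ?_
  have hx0 : P.eval x = 0 := (mem_roots hP.ne_zero).1 (Multiset.mem_toFinset.1 hx)
  have h1 := eval_mul_eval_derivative_eq_one huv hx0
  have hv : SignType.sign (v.eval x) = SignType.sign ((derivative P).eval x) := by
    have hpos : 0 < v.eval x * (derivative P).eval x := by rw [h1]; exact one_pos
    rcases pos_and_pos_or_neg_and_neg_of_mul_pos hpos with ⟨h1', h2'⟩ | ⟨h1', h2'⟩
    · rw [sign_pos h1', sign_pos h2']
    · rw [sign_neg h1', sign_neg h2']
  rw [eval_mul, sign_mul, sign_mul, hv]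

/-- **The two indices: `sigPos H_t(a/P) = #{x ∈ roots_ℝ P | a(x)P′(x) > 0} + #{z ∈ Zer(P, ℂ) | Im z > 0, a(z) ≠ 0}`, `sigNeg H_t(a/P) = #{x | a(x)P′(x) < 0} + #{the same pairs}`** (`u P + v P′ = 1`;
N128 for `Q = a v`, and `v(z) P′(z) = 1` at complex roots too). [this file, §757] -/
theorem sigPos_sigNeg_hankelSq_dualSeq_real_of_isCoprime {t : ℕ} {P u v : ℝ[X]} (hP : P.Monic) (hPd : P.natDegree ≤ t + 1) (huv : u * P + v * derivative P = 1) (a : ℝ[X]) :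
    sigPos (hankelSq ℝ t (dualSeq ℝ P a)).toQuadraticForm'
        = (P.roots.toFinset.filter fun x => 0 < a.eval x * (derivative P).eval x).card + ((P.aroots ℂ).toFinset.filter fun z => 0 < z.im ∧ (a.map (algebraMap ℝ ℂ)).eval z ≠ 0).card
      ∧ sigNeg (hankelSq ℝ t (dualSeq ℝ P a)).toQuadraticForm'
        = (P.roots.toFinset.filter fun x => a.eval x * (derivative P).eval x < 0).card + ((P.aroots ℂ).toFinset.filter fun z => 0 < z.im ∧ (a.map (algebraMap ℝ ℂ)).eval z ≠ 0).card := by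
  obtain ⟨hp, hn⟩ := sigPos_sigNeg_hankelSq_dualSeq_mul_derivative_real hP hPd (a * v)
  rw [dualSeq_eq_dualSeq_mul_mul_derivative hP huv a, hp, hn]
  -- real roots: `(a v)(x) > 0 ⟺ a(x) P′(x) > 0` since `v(x) P′(x) = 1`
  have hre : ∀ x ∈ P.roots.toFinset, (0 < (a * v).eval x ↔ 0 < a.eval x * (derivative P).eval x) ∧ ((a * v).eval x < 0 ↔ a.eval x * (derivative P).eval x < 0) := by
    intro x hx
    have hx0 : P.eval x = 0 := (mem_roots hP.ne_zero).1 (Multiset.mem_toFinset.1 hx)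
    have h1 := eval_mul_eval_derivative_eq_one huv hx0
    have key : (a * v).eval x * ((derivative P).eval x * (derivative P).eval x) = a.eval x * (derivative P).eval x := by
      rw [eval_mul]; linear_combination a.eval x * (derivative P).eval x * h1
    have hd : (derivative P).eval x ≠ 0 := fun h => by rw [h, mul_zero] at h1; exact zero_ne_one h1
    have hsq : 0 < (derivative P).eval x * (derivative P).eval x := mul_self_pos.2 hd
    rw [← key]
    exact ⟨(mul_pos_iff_of_pos_right hsq).symm, by rw [mul_neg_iff, or_iff_right fun h => (not_lt.2 hsq.le) h.2]; exact ⟨fun h => ⟨h, hsq⟩, fun h => h.1⟩⟩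
  -- complex roots: `(a v)(z) ≠ 0 ⟺ a(z) ≠ 0`
  have hcx : ∀ z ∈ (P.aroots ℂ).toFinset, (((a * v).map (algebraMap ℝ ℂ)).eval z ≠ 0 ↔ (a.map (algebraMap ℝ ℂ)).eval z ≠ 0) := by
    intro z hz
    have hz0 : (P.map (algebraMap ℝ ℂ)).eval z = 0 := by
      have := Multiset.mem_toFinset.1 hz
      rw [mem_aroots] at this
      rw [eval_map_algebraMap]; exact this.2
    have h1 : (v.map (algebraMap ℝ ℂ)).eval z * ((derivative P).map (algebraMap ℝ ℂ)).eval z = 1 := by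
      have h := congrArg (fun f : ℝ[X] => (f.map (algebraMap ℝ ℂ)).eval z) huv
      simp only [Polynomial.map_add, Polynomial.map_mul, Polynomial.map_one, eval_add, eval_mul, eval_one, hz0, mul_zero, zero_add] at h
      exact h
    have hv : (v.map (algebraMap ℝ ℂ)).eval z ≠ 0 := fun h => by rw [h, zero_mul] at h1; exact zero_ne_one h1
    rw [Polynomial.map_mul, eval_mul, mul_ne_zero_iff]
    exact ⟨fun h => h.1, fun h => ⟨h, hv⟩⟩
  refine ⟨?_, ?_⟩
  · rw [Finset.filter_congr fun x hx => (hre x hx).1, Finset.filter_congr fun z hz => and_congr_right fun _ => hcx z hz]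
  · rw [Finset.filter_congr fun x hx => (hre x hx).2, Finset.filter_congr fun z hz => and_congr_right fun _ => hcx z hz]

/-- **`Sign H_t(a/P) = Σ_{x ∈ roots_ℝ P} sign(a(x) P′(x))` for `P` monic real SEPARABLE, `deg P ≤ t + 1`, any `a`.** [this file, §757] -/
theorem sigPos_sub_sigNeg_hankelSq_dualSeq_real_of_separable {t : ℕ} {P : ℝ[X]} (hP : P.Monic) (hsep : P.Separable) (hPd : P.natDegree ≤ t + 1) (a : ℝ[X]) :
    (sigPos (hankelSq ℝ t (dualSeq ℝ P a)).toQuadraticForm' : ℤ) - sigNeg (hankelSq ℝ t (dualSeq ℝ P a)).toQuadraticForm'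
      = ∑ x ∈ P.roots.toFinset, (SignType.sign (a.eval x * (derivative P).eval x) : ℤ) := by
  obtain ⟨u, v, huv⟩ := (Polynomial.separable_def P).1 hsep
  exact sigPos_sub_sigNeg_hankelSq_dualSeq_real_of_isCoprime hP hPd huv a

/-! ## §758. Hermite–Hurwitz: the signature is the Cauchy index -/

/-- **HERMITE–HURWITZ ∕ BPR Thm. 9.4 (2) for separable `P`: `Sign H_t(a/P) = Ind(a/P; lo, hi)`** — for `P` monic real separable of degree `≤ t + 1`, any numerator `a`, and any window `(lo, hi)`
containing the real roots of `P`, the signature of the Hankel form of `a/P` is the tree's Cauchy index `cauchyIndex P a lo hi` (`a ≡ (a v) P′ mod P`; Literature `cauchyIndex_mod`,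
`tarskiQuery_eq_cauchyIndex`; N129 `tarskiQuery_eq_sum_sign`). [this file, §758] -/
theorem sigPos_sub_sigNeg_hankelSq_dualSeq_eq_cauchyIndex {t : ℕ} {P : ℝ[X]} (hP : P.Monic) (hsep : P.Separable) (hPd : P.natDegree ≤ t + 1) (a : ℝ[X]) {lo hi : ℝ} (hab : ∀ x ∈ P.roots, lo < x ∧ x < hi) :
    (sigPos (hankelSq ℝ t (dualSeq ℝ P a)).toQuadraticForm' : ℤ) - sigNeg (hankelSq ℝ t (dualSeq ℝ P a)).toQuadraticForm' = Literature.Algebra.Polynomial.cauchyIndex P a lo hi := by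
  obtain ⟨u, v, huv⟩ := (Polynomial.separable_def P).1 hsep
  have hmod : a % P = (derivative P * (a * v)) % P := by
    rw [← Polynomial.modByMonic_eq_mod a hP, ← Polynomial.modByMonic_eq_mod _ hP]
    exact Polynomial.modByMonic_eq_of_dvd_sub hP ⟨a * u, by linear_combination (-a) * huv⟩
  rw [dualSeq_eq_dualSeq_mul_mul_derivative hP huv a, sigPos_sub_sigNeg_hankelSq_dualSeq_mul_derivative_real hP hPd (a * v), ← tarskiQuery_eq_sum_sign P (a * v) hab,
    Literature.Algebra.Polynomial.tarskiQuery_eq_cauchyIndex _ _ hP.ne_zero, ← Literature.Algebra.Polynomial.cauchyIndex_mod P (derivative P * (a * v)), ← hmod,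
    Literature.Algebra.Polynomial.cauchyIndex_mod]

/-- **`Ind(a/P; lo, hi) = Σ_{x ∈ roots_ℝ P} sign(a(x) P′(x))` for `P` monic separable with its real roots in `(lo, hi)`** (simple poles: the jump at `x` is the sign of `a(x)/P′(x)`). [this file, §758] -/
theorem cauchyIndex_eq_sum_sign_mul_derivative {P : ℝ[X]} (hP : P.Monic) (hsep : P.Separable) (a : ℝ[X]) {lo hi : ℝ} (hab : ∀ x ∈ P.roots, lo < x ∧ x < hi) :
    Literature.Algebra.Polynomial.cauchyIndex P a lo hi = ∑ x ∈ P.roots.toFinset, (SignType.sign (a.eval x * (derivative P).eval x) : ℤ) := by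
  rw [← sigPos_sub_sigNeg_hankelSq_dualSeq_eq_cauchyIndex (t := P.natDegree) hP hsep (Nat.le_succ _) a hab, sigPos_sub_sigNeg_hankelSq_dualSeq_real_of_separable hP hsep (Nat.le_succ _)]

end Summit.Ventures.HSemireg.Wedge.HankelOuter
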